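import Summits.BirchSwinnertonDyer.BirchSwinnertonDyer.Theorems.KimAtThreeShallowEqDeepGoodCoreVertexCore
import Summits.BirchSwinnertonDyer.Rank1Residual.GaloisImage.PropagatedStructureCartesian
import HarnessLib

/-!
# Route `KimAtThreeKolyvagin` (rung W2), crux `ShallowEqDeepAtTorsionFree` (stmt-BirchSwinnertonDyer-19077):
# the `hord` clause of the END core — `λ^*(d) = 0` for the INDUCED residual structure of `𝓕_can(d)`
# from ONE local statement at the primes of `d`, and `addOrderOf (g d) = 3^{k+1}` from [S24]'s clause

Cell `bsd-addord`, seat `bsd-addord-w2-c4` (D-0074 row B7), gen 3; fifth file of the GOOD CORE VERTEX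
port (siblings `KimAtThreeShallowEqDeepGoodCoreVertex{,Rat,Devissage,Core}`).  TOOL theorems only (no
definition, no named fact, no `sorry`); nothing asserted about any curve; nothing booked.

* §11 `lambdaStar_induced_atLevel_eq_zero_of_transverse_onto`: at a level `d` where the dual Selmer
  group of the residual KUMMER structure vanishes (files 1–2), the dual Selmer group of the residual
  structure `(𝓕_can^{(k)}(d))̄ := (D.atLevel 𝓕_can d).induced [3^k]` (the structure on which [S24]
  Thm. 4.4 (1)'s bijectivity clause is read, n1011 `SakamotoN11InstanceDeep`) vanishes — i.e.
  `λ^*(d) = 0` — PROVIDED the local ONTO statement at the primes of `d`: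
  `𝒯(ℚ_q, E[3]) ≤ [3^k]_* 𝒯(ℚ_q, E[3^k·3])` (hypothesis `honto`; true at a Kolyvagin prime of level
  `3^{k+1}` — `H¹_tr ≅ M^{Frob}` and `[3^k]` maps invariants onto invariants — NOT yet a tree lemma;
  off `d` the induced structure IS `𝓕̄_can ⊇ 𝓚̄` by n1011 `induced_propagatedSelmerStructure`).
* §12 `addOrderOf_apply_eq_of_bijective`: pure algebra — if `KS₁` is free of rank one over `ℤ/3^{k+1}`,
  every system is a multiple of `g`, and `κ ↦ κ_d` is a bijection `KS₁ → H¹_{𝓕_can(d)}` (the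
  conclusion of [S24] Thm. 4.4 (1) at `λ^*(d) = 0`), then `addOrderOf (g d) = 3^{k+1}` — VERBATIM the
  `hord` of `KimAtThreeDeepUpperEndCore.EndCore.exists_certificate_of_witnessAt`.
So after the five files the GOOD CORE VERTEX port of cruxes 19076/19077 is reduced to: the S24(-DEEP)
freeness/bijectivity (named fact / port, already carried by the route's rungs) and ONE local lemma
(`honto`).  References: [Sakamoto2024] Thm. 4.4 (1), Def. 3.3, §6; [MazurRubin2004] Thm. 4.4.1,
Cor. 4.1.9; [Rubin2011] Prop. 1.9.5, Def. 2.5.3.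
-/

set_option autoImplicit false
-- the Theorems namespace of a single-conjunct summit repeats the summit name by design (D-0017)
set_option linter.dupNamespace false

noncomputable section

open scoped Classical NumberField ContRepresentation
open Function Field NumberField IsDedekindDomain
open Literature.NumberTheory.GaloisRepresentations Literature.NumberTheory.GaloisRepresentations.DiscreteGaloisModule
  Literature.NumberTheory.GaloisCohomology
open Summit.BirchSwinnertonDyer.Rank1Residual.GaloisImage
open Summit.BirchSwinnertonDyer.Rank1Residual.GaloisImage.CoreRankZero
open Summit.BirchSwinnertonDyer.Rank1Residual.X11b.Levels

universe u

namespace Summit.BirchSwinnertonDyer.BirchSwinnertonDyer.Theorems.KimAtThreeShallowEqDeepGoodCoreVertex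

/-! ## §11. `λ^*(d) = 0` for the induced residual structure of `𝓕_can(d)` -/

section Induced

variable {K : Type u} [Field K] [NumberField K]
variable {M : Type u} [AddCommGroup M] [TopologicalSpace M] [DiscreteTopology M]
  {Mbar : Type u} [AddCommGroup Mbar] [TopologicalSpace Mbar] [DiscreteTopology Mbar]
variable {ρ : DiscreteGaloisModule K M} {ρbar : DiscreteGaloisModule K Mbar}

/-- Unfolding the induced structure of a LEVEL structure place by place: off `d` it is the induced
structure of `𝓕`, at `q ∈ d` the image of the transverse condition.
[cite: Sakamoto2024, §2 (p. 921) and Def. 3.3 (p. 922)] -/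
theorem induced_atLevel_apply (D : KolyvaginDatum ρ) (𝓕 : SelmerStructure ρ)
    (red : ρ.toContRepresentation →ⁱL ρbar.toContRepresentation)
    (d : Finset (HeightOneSpectrum (𝓞 K))) (v : Place K) :
    (D.atLevel 𝓕 d).induced red v = ((D.atLevel 𝓕 d) v).map (localMap red v) := rfl

/-- **A residual structure `𝓖 ≥ 𝓛(d)` place by place makes `H¹_{𝓖^*} = 0` whenever `H¹_{𝓛(d)^*} = 0`.**
If `(𝓕(d)).induced red ⊇ 𝓛` off `d` agrees with a structure containing `𝓛`, and at `q ∈ d` contains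
`𝓛`'s transverse condition, then the dual Selmer group of the induced structure lies in that of
`𝓛(d)`. [cite: Howard2004HeegnerKolyvagin, Thm. 2.1.11] [cite: Sakamoto2024, Def. 3.3 (p. 922)] -/
theorem dualSelmerGroup_induced_atLevel_eq_bot_of_le [Finite Mbar] {n : ℕ} (inv : LocalInvariants K n)
    (D : KolyvaginDatum ρ) (Dbar : KolyvaginDatum ρbar) (𝓕 : SelmerStructure ρ)
    (𝓛 : SelmerStructure ρbar) (red : ρ.toContRepresentation →ⁱL ρbar.toContRepresentation)
    (d : Finset (HeightOneSpectrum (𝓞 K)))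
    (hoff : ∀ v : Place K, 𝓛 v ≤ (𝓕 v).map (localMap red v))
    (honto : ∀ q ∈ d, Dbar.transverse (Sum.inr q) ≤ (D.transverse (Sum.inr q)).map (localMap red (Sum.inr q)))
    (hbot : (inv.dualSelmerStructure ρbar (Dbar.atLevel 𝓛 d)).selmerGroup = ⊥) :
    (inv.dualSelmerStructure ρbar ((D.atLevel 𝓕 d).induced red)).selmerGroup = ⊥ := by
  have hle : Dbar.atLevel 𝓛 d ≤ (D.atLevel 𝓕 d).induced red := by
    intro v
    rw [induced_atLevel_apply]
    rcases v with w | q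
    · rw [Level.atLevel_inl, Level.atLevel_inl]
      exact hoff _
    · by_cases hq : q ∈ d
      · rw [Level.atLevel_inr_of_mem Dbar _ hq, Level.atLevel_inr_of_mem D _ hq]
        exact honto q hq
      · rw [Level.atLevel_inr_of_not_mem Dbar _ hq, Level.atLevel_inr_of_not_mem D _ hq]
        exact hoff _
  exact le_bot_iff.1 (hbot ▸ inv.selmerGroup_dualSelmerStructure_anti ρbar hle)

end Induced

section InducedCurve

open WeierstrassCurve Literature.NumberTheory.EllipticCurves

variable (W : WeierstrassCurve ℚ) [W.IsElliptic] (k : ℕ)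

/-- **`λ^*(d) = 0` for the induced residual structure of `𝓕_can^{(k)}(d)`** — the hypothesis of the
bijectivity clause of [S24] Thm. 4.4 (1) at the level `d` (n1011 `SakamotoN11InstanceDeep`:
`lambdaStar inv ((D.atLevel 𝓕_can d).induced [3^k]) 3 = 0`) — from the vanishing of the dual Selmer
group of the residual KUMMER structure at `d` (files 1–2) and the local ONTO hypothesis `honto` at
the primes of `d`; off `d`, `(𝓕_can^{(k)}).induced [3^k] = 𝓕̄_can ⊇ 𝓚̄` by n1011
`induced_propagatedSelmerStructure` and `kummerSelmerStructure_le_propagatedSelmerStructureOne`.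
[cite: Sakamoto2024, Thm. 4.4 (1) (p. 926) and §6 (p. 930)] [cite: Rubin2011, Def. 2.5.3 (p. 21)] -/
theorem lambdaStar_induced_atLevel_eq_zero_of_transverse_onto [Finite (geomTorsion W ((3 : ℕ) : ℤ))]
    (inv : LocalInvariants ℚ 3)
    (D₁ : KolyvaginDatum (W.torsionGaloisModule ((3 : ℕ) : ℤ)))
    (D₂ : KolyvaginDatum (W.torsionGaloisModule (((3 : ℕ) : ℤ) ^ k * ((3 : ℕ) : ℤ))))
    (d : Finset (HeightOneSpectrum (𝓞 ℚ)))
    (honto : ∀ q ∈ d, D₁.transverse (Sum.inr q) ≤ (D₂.transverse (Sum.inr q)).map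
      (localMap (W.torsionMulBy (((3 : ℕ) : ℤ) ^ k) ((3 : ℕ) : ℤ)) (Sum.inr q)))
    (hbot : (inv.dualSelmerStructure (W.torsionGaloisModule ((3 : ℕ) : ℤ))
      (D₁.atLevel (W.kummerSelmerStructure ((3 : ℕ) : ℤ)) d)).selmerGroup = ⊥) :
    LocalInvariants.lambdaStar inv ((D₂.atLevel (propagatedSelmerStructure W 3 k) d).induced
      (W.torsionMulBy (((3 : ℕ) : ℤ) ^ k) ((3 : ℕ) : ℤ))) 3 = 0 := by
  haveI : Fact (Nat.Prime 3) := ⟨Nat.prime_three⟩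
  have hoff : ∀ v : Place ℚ, W.kummerSelmerStructure ((3 : ℕ) : ℤ) v ≤
      ((propagatedSelmerStructure W 3 k) v).map
        (localMap (W.torsionMulBy (((3 : ℕ) : ℤ) ^ k) ((3 : ℕ) : ℤ)) v) := by
    intro v
    have h := congrFun (induced_propagatedSelmerStructure W 3 k) v
    change ((propagatedSelmerStructure W 3 k) v).map _ = _ at h
    rw [h]
    exact KummerCondition.kummerSelmerStructure_le_propagatedSelmerStructureOne W 3 v
  have h0 := dualSelmerGroup_induced_atLevel_eq_bot_of_le inv D₂ D₁ (propagatedSelmerStructure W 3 k)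
    (W.kummerSelmerStructure ((3 : ℕ) : ℤ)) (W.torsionMulBy (((3 : ℕ) : ℤ) ^ k) ((3 : ℕ) : ℤ)) d hoff
    honto hbot
  unfold LocalInvariants.lambdaStar
  rw [h0, AddSubgroup.card_bot, Nat.log_one_right]

end InducedCurve

/-! ## §12. `hord` from the bijectivity clause: pure algebra -/

section Order

variable {K : Type u} [Field K] [NumberField K]
variable {M : Type u} [AddCommGroup M] [TopologicalSpace M] [DiscreteTopology M]
variable {ρ : DiscreteGaloisModule K M}

/-- **`addOrderOf (g d) = N` from [S24] Thm. 4.4 (1)'s conclusion at `d`.**  If `KS₁` is free of rank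
one over `ℤ/N` (`IsFreeRankOneZMod`), every system is a multiple of `g ∈ KS₁`, and `κ ↦ κ_d` is a
bijection `KS₁ → H¹_{𝓕(d)}` (the clause at `λ^*(d) = 0`), then `g d` has additive order `N` — VERBATIM
the `hord` of `KimAtThreeDeepUpperEndCore.EndCore.exists_certificate_of_witnessAt` (`N = 3^{k+1}`):
`g` generates the cyclic group `KS₁ ≃ ℤ/N`, so `addOrderOf g = N`, and the bijection is an
injective homomorphism, so `addOrderOf (g d) = addOrderOf g`. [cite: Sakamoto2024, Thm. 4.4 (1) (p. 926)]
[cite: MazurRubin2004, Thm. 4.4.1] -/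
theorem addOrderOf_apply_eq_of_bijective {D : KolyvaginDatum ρ} {𝓕 : SelmerStructure ρ} {N : ℕ}
    [NeZero N] (hfree : KolyvaginSystem.IsFreeRankOneZMod (D.kolyvaginSystems 𝓕) N)
    (g : Finset (HeightOneSpectrum (𝓞 K)) → galoisCohomology ρ 1) (hg : g ∈ D.kolyvaginSystems 𝓕)
    (hgen : ∀ κ ∈ D.kolyvaginSystems 𝓕, ∃ a : ℕ, κ = a • g)
    {d : Finset (HeightOneSpectrum (𝓞 K))} (hd : D.IsLevel d)
    (hbij : Function.Bijective fun κ : D.kolyvaginSystems 𝓕 =>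
      (⟨κ.1 d, ((KolyvaginDatum.mem_kolyvaginSystems_iff D 𝓕 κ.1).mp κ.2).mem_selmerGroup d hd⟩ :
        (D.atLevel 𝓕 d).selmerGroup)) :
    addOrderOf (g d) = N := by
  obtain ⟨e⟩ := hfree
  haveI : Finite (D.kolyvaginSystems 𝓕) := Finite.of_equiv _ e.toEquiv.symm
  have hcard : Nat.card (D.kolyvaginSystems 𝓕) = N := by
    rw [Nat.card_congr e.toEquiv, Nat.card_zmod]
  -- `g` generates `KS₁`, so `addOrderOf g = #KS₁ = N`
  set g' : D.kolyvaginSystems 𝓕 := ⟨g, hg⟩ with hg'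
  have htop : AddSubgroup.zmultiples g' = ⊤ := by
    rw [eq_top_iff]
    rintro κ -
    obtain ⟨a, ha⟩ := hgen κ.1 κ.2
    exact ⟨a, Subtype.ext (by rw [hg']; push_cast; rw [natCast_zsmul]; exact ha.symm)⟩
  have hordg : addOrderOf g' = N := by
    rw [← Nat.card_zmultiples g', htop, AddSubgroup.card_top, hcard]
  -- the evaluation at `d` is an injective homomorphism, so it preserves the order
  let ev : D.kolyvaginSystems 𝓕 →+ (D.atLevel 𝓕 d).selmerGroup :=
    { toFun := fun κ => ⟨κ.1 d, ((KolyvaginDatum.mem_kolyvaginSystems_iff D 𝓕 κ.1).mp κ.2).mem_selmerGroup d hd⟩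
      map_zero' := rfl
      map_add' := fun _ _ => rfl }
  have hev : Function.Injective ev := hbij.1
  have h1 : addOrderOf (ev g') = addOrderOf g' := addOrderOf_injective ev hev g'
  have h2 : addOrderOf (ev g') = addOrderOf (g d) := AddSubgroup.addOrderOf_mk (g d) _
  rw [← h2, h1, hordg]

end Order

end Summit.BirchSwinnertonDyer.BirchSwinnertonDyer.Theorems.KimAtThreeShallowEqDeepGoodCoreVertex

end
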